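import Literature.Algebra.Homology.DiscreteRepStandardResolutionNaturality
import Literature.Algebra.Homology.DiscreteRepLayerBoundary
import Literature.NumberTheory.GaloisRepresentations.ContinuousShapiroOpenCoinducedRightAction
import HarnessLib

/-!
# `Hⁿ(f)` READ ON THE LAYERS of `Hⁿ_cont(Γ, X) = lim→ Hⁿ(Γ⧸V, X^V)`: `Hⁿ(f)(Inf_V c) = Inf_V (Hⁿ(Γ⧸V, f^V) c)`;
# in particular the right translations `R_c` of `Maps(Γ⧸W, M)` act on layer representatives
# (Serre, *Cohomologie galoisienne* I §2.2 Prop. 8; NSW (1.5.1))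

Topic `Algebra/Homology`; namespace `Literature.Algebra.Homology.DiscreteRep.LayerColimit`.
THEOREMS ONLY (no definition, no named fact, no `sorry`, no instance).

For a compact group `Γ` and a morphism `f : X ⟶ Y` of topologically discrete `Γ`-modules with open
stabilisers, the map `Hⁿ(f) : Hⁿ_cont(Γ, X) → Hⁿ_cont(Γ, Y)` of Mathlib's continuous cohomology reads,
on a class inflated from the finite layer `V` (`inflG V`, door-c4's `DiscreteRepLayerColimitGroupCohomology`,
through the comparison `Φ = extTrivAddEquivContinuousCohomology`), as inflation of the class mapped by
Mathlib's `groupCohomology.map (id) (f^V)` at the layer — the composition of the tree's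
`extTrivAddEquivContinuousCohomology_naturality` (naturality of `Φ` in the module) and `inflG_map`
(naturality of `Inf_V` in the module):

* `map_extTriv_inflG` — the general statement;
* `coindOpenHRep_extTriv_inflG` — the case of the right translation `R_c` of `Maps(Γ ⧸ W, M)`
  (`ContinuousRep.coindOpenHRep`, -w7 g9): the `Δ = Γ ⧸ W`-action on `Hⁿ_cont(Γ, Maps(Δ, M))` acts on
  layer representatives by `Hⁿ(Γ⧸V, (R_c)^V)`.

Lane «TATE-EPC-TC» of cell `bsd-eis` (crux `GoodLatticeBDPValue`, stmt-BirchSwinnertonDyer-19032), piece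
(θ-i)-top, layer half, part 1.  HONEST FRAMING: homological algebra only.

## References
* J.-P. Serre, *Cohomologie galoisienne* (1994), I §2.2 Prop. 8. [SerreGaloisCohomology1997]
* J. Neukirch, A. Schmidt, K. Wingberg, *Cohomology of Number Fields*, 2nd ed. (2008), (1.5.1), I §6.
  [NeukirchSchmidtWingberg2008]
-/

noncomputable section

universe u

namespace Literature.Algebra.Homology

namespace DiscreteRep

namespace LayerColimit

open CategoryTheory CategoryTheory.Limits CategoryTheory.Abelian TopRep ContRepresentation ContinuousCohomology

variable {k Γ : Type u} [CommRing k] [TopologicalSpace k] [Group Γ] [TopologicalSpace Γ]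
  [IsTopologicalGroup Γ] [CompactSpace Γ]
  {X Y : TopRep.{u} k Γ} [DiscreteTopology X.V] [DiscreteTopology Y.V]
  (hX : IsDiscrete ((forgetTop k Γ).obj X)) (hY : IsDiscrete ((forgetTop k Γ).obj Y)) (f : X ⟶ Y)

/-- **`Hⁿ(f) (Φ (Inf_V c)) = Φ (Inf_V (Hⁿ(Γ⧸V, f^V) c))`**: a morphism of discrete `Γ`-modules acts on
layer representatives layer-wise. [cite: SerreGaloisCohomology1997, I §2.2 Prop. 8]
[cite: NeukirchSchmidtWingberg2008, (1.5.1)] -/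
theorem map_extTriv_inflG (V : OpenNormalSubgroup Γ) (n : ℕ)
    (c : groupCohomology ((invariantsQuotFunctor k (V : Subgroup Γ)).obj (stdBase X hX)) n) :
    (ContinuousCohomology.map (ContinuousMonoidHom.id Γ) (X := X) (Y := Y) f n).hom
        (extTrivAddEquivContinuousCohomology X hX n (inflG V (stdBase X hX) n c)) =
      extTrivAddEquivContinuousCohomology Y hY n
        (inflG V (stdBase Y hY) n ((groupCohomology.map (MonoidHom.id _)
          ((invariantsQuotFunctor k (V : Subgroup Γ)).map (stdBaseMap hX hY f)) n).hom c)) := by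
  rw [extTrivAddEquivContinuousCohomology_naturality hX hY f n, inflG_map]

end LayerColimit

end DiscreteRep

end Literature.Algebra.Homology

/-! ### The right translations of `Maps(Γ ⧸ W, M)` on layer representatives -/

namespace Literature.NumberTheory.GaloisRepresentations

namespace ContinuousRep

open CategoryTheory Literature.Algebra.Homology Literature.Algebra.Homology.DiscreteRep
  Literature.Algebra.Homology.DiscreteRep.LayerColimit
open _root_.TopRep _root_.ContRepresentation _root_.ContinuousCohomology

variable {G : Type} [Group G] [TopologicalSpace G] [IsTopologicalGroup G] [CompactSpace G]
variable {M : Type} [AddCommGroup M] [TopologicalSpace M] [DiscreteTopology M]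
variable (ρ : ContinuousRep G ℤ M) (W : Subgroup G) [W.Normal] (hW : IsOpen (W : Set G))

omit [W.Normal] in
/-- `Maps(G ⧸ W, M)` has open stabilisers (it is a continuous representation on a discrete module).
[cite: SerreGaloisCohomology1997, I §2.1] -/
theorem isDiscrete_coindOpen :
    IsDiscrete ((forgetTop ℤ G).obj (ρ.coindOpen W hW).toTopRep) :=
  haveI : DiscreteTopology (G ⧸ W → M) := discreteTopology_coindOpen W hW
  isDiscrete_of_continuousRep (ρ.coindOpen W hW)

/-- **The `Δ`-action `coindOpenHRep` on layer representatives**: for `c ∈ Δ = G ⧸ W` and a class of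
`Hⁿ_cont(G, Maps(Δ, M))` inflated from the layer `V`,
`R_c (Φ (Inf_V y)) = Φ (Inf_V (Hⁿ(G⧸V, (R_c)^V) y))`.
[cite: NeukirchSchmidtWingberg2008, I §6 (induced modules), (1.5.1)] [cite: SerreGaloisCohomology1997, I §2.2 Prop. 8] -/
theorem coindOpenHRep_extTriv_inflG (hD : DiscreteTopology (ρ.coindOpen W hW).toTopRep.V)
    (V : OpenNormalSubgroup G) (n : ℕ) (c : G ⧸ W)
    (y : groupCohomology ((invariantsQuotFunctor ℤ (V : Subgroup G)).obj
      (stdBase (ρ.coindOpen W hW).toTopRep (ρ.isDiscrete_coindOpen W hW))) n) :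
    ρ.coindOpenHRep W hW n c
        (extTrivAddEquivContinuousCohomology (ρ.coindOpen W hW).toTopRep (ρ.isDiscrete_coindOpen W hW) n
          (inflG V _ n y)) =
      extTrivAddEquivContinuousCohomology (ρ.coindOpen W hW).toTopRep (ρ.isDiscrete_coindOpen W hW) n
        (inflG V _ n ((groupCohomology.map (MonoidHom.id _)
          ((invariantsQuotFunctor ℤ (V : Subgroup G)).map
            (stdBaseMap (ρ.isDiscrete_coindOpen W hW) (ρ.isDiscrete_coindOpen W hW)
              (ρ.coindOpenRTrans W hW c))) n).hom y)) := by
  rw [coindOpenHRep_apply]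
  exact map_extTriv_inflG _ _ (ρ.coindOpenRTrans W hW c) V n y

end ContinuousRep

end Literature.NumberTheory.GaloisRepresentations

end
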